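import Mathlib

/-!
# T5EmbeddingDensity — the `ℚ`-points of `Res_{K/ℚ} 𝔾_m` are Zariski-dense
(T4-B3 §B3(d.3), the «standard fact without a held locator»)

T4-B3 §B3(d.3) (route/T4-B3-p2.md) uses «the Zariski density of the ℚ-points of
`Res_{k′/ℚ} 𝔾_m`» to pass from an identity of characters on `k′^×` to an identity of algebraic
characters of the torus. In the coordinates `k′ ⊗_ℚ ℂ ≅ ℂ^{Hom(k′,ℂ)}` (`x ↦ (σ(x))_σ`), the
statement is: a complex polynomial in the variables indexed by the embeddings `σ : k′ → ℂ`
that vanishes at `(σ(x))_σ` for every `x ∈ k′` (resp. every `x ∈ k′^×`) is the zero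
polynomial. This file proves it.

* `linSubst`, `eval_linSubst`, `linSubst_injective` — the linear change of variables
  `X_i ↦ ∑_j A_{ij} X_j` on `ℂ[X_1, …, X_n]` and its injectivity for invertible `A`;
* `embedding_eq_mulVec` — the embedding vector of `x = ∑ q_j b_j` is `Mᵀ q` with
  `M = embeddingsMatrixReindex` (the matrix `σ_j(b_i)`), and `isUnit_det_embeddingsMatrix` —
  `M` is invertible (`discr ≠ 0`, `Algebra.discr_eq_det_embeddingsMatrixReindex_pow_two`);
* **`eq_zero_of_forall_eval_embedding_eq_zero`** — a polynomial in `finrank ℚ K` variables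
  vanishing on the embedding vectors of all `x ∈ K` is zero (`MvPolynomial.funext_set` on the
  box `ℚ^n`, transported by the invertible linear change of variables);
* `eq_zero_of_forall_eval_hom_eq_zero` / `exists_eval_hom_ne_zero` — the same with the
  variables indexed by `K →ₐ[ℚ] ℂ` itself;
* **`exists_ne_zero_eval_hom_ne_zero`** — the torus form: a non-zero polynomial is non-zero at
  the embedding vector of some `x ∈ K^×`.

Nothing about restriction of scalars or characters is formalised: `K` is any number field,
the «ℚ-points» are the elements of `K`.
-/

namespace Summit.Ventures.HodgeRepro2.T5EmbeddingDensity

open MvPolynomial Matrix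

noncomputable section

/-! ## §1 Linear change of variables -/

section Subst

variable {n : ℕ}

/-- The linear substitution `X_i ↦ ∑_j A_{ij} X_j`. -/
def linSubst (A : Matrix (Fin n) (Fin n) ℂ) :
    MvPolynomial (Fin n) ℂ →ₐ[ℂ] MvPolynomial (Fin n) ℂ :=
  bind₁ fun i => ∑ j, C (A i j) * X j

/-- Evaluating after the substitution is evaluating at `A *ᵥ x`. -/
theorem eval_linSubst (A : Matrix (Fin n) (Fin n) ℂ) (x : Fin n → ℂ)
    (f : MvPolynomial (Fin n) ℂ) : eval x (linSubst A f) = eval (A *ᵥ x) f := by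
  unfold linSubst
  rw [← aeval_eq_eval, aeval_bind₁, aeval_eq_eval]
  have : (fun i => aeval x (∑ j, C (A i j) * X j)) = A *ᵥ x := by
    funext i
    simp only [map_sum, map_mul, aeval_C, aeval_X, mulVec, dotProduct, Algebra.algebraMap_self,
      RingHom.id_apply]
  rw [this]

/-- For invertible `A` the substitution is injective. -/
theorem linSubst_injective (A : Matrix (Fin n) (Fin n) ℂ) (hA : IsUnit A.det) :
    Function.Injective (linSubst A) := by
  intro f g h
  apply MvPolynomial.funext
  intro y
  have := congrArg (eval (A⁻¹ *ᵥ y)) h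
  rwa [eval_linSubst, eval_linSubst, mulVec_mulVec, mul_nonsing_inv A hA, one_mulVec] at this

end Subst

/-! ## §2 The embedding vectors of a number field -/

section Embeddings

variable {K : Type*} [Field K] [NumberField K] {n : ℕ}

/-- The embedding vector of `x = ∑_j q_j b_j` is `Mᵀ q`, `M = embeddingsMatrixReindex ℚ ℂ b e`
(`M i j = (e j) (b i)`). -/
theorem embedding_eq_mulVec (b : Module.Basis (Fin n) ℚ K) (e : Fin n ≃ (K →ₐ[ℚ] ℂ)) (x : K) :
    (fun i => e i x) =
      (Algebra.embeddingsMatrixReindex ℚ ℂ b e)ᵀ *ᵥ (fun j => ((b.repr x j : ℚ) : ℂ)) := by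
  funext i
  conv_lhs => rw [← b.sum_repr x]
  rw [map_sum]
  simp only [mulVec, dotProduct, transpose_apply, Algebra.embeddingsMatrixReindex,
    Algebra.embeddingsMatrix, reindex_apply, submatrix_apply, Equiv.refl_symm, Equiv.coe_refl,
    id_eq, Equiv.symm_symm, of_apply]
  refine Finset.sum_congr rfl fun j _ => ?_
  rw [Algebra.smul_def, map_mul, AlgHom.commutes, eq_ratCast, mul_comm]

/-- The embeddings matrix of a basis of a number field is invertible. -/
theorem isUnit_det_embeddingsMatrix (b : Module.Basis (Fin n) ℚ K)
    (e : Fin n ≃ (K →ₐ[ℚ] ℂ)) : IsUnit (Algebra.embeddingsMatrixReindex ℚ ℂ b e)ᵀ.det := by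
  rw [det_transpose, isUnit_iff_ne_zero]
  intro h
  have hd := Algebra.discr_eq_det_embeddingsMatrixReindex_pow_two ℚ ℂ b e
  rw [h, zero_pow two_ne_zero] at hd
  exact Algebra.discr_not_zero_of_basis ℚ b ((algebraMap ℚ ℂ).injective (by rw [hd, map_zero]))

/-- **Zariski density of the embedding vectors.** A polynomial in `n` variables (indexed through
a bijection `e : Fin n ≃ (K →ₐ[ℚ] ℂ)`) vanishing at `(e i x)_i` for every `x ∈ K` is zero. -/
theorem eq_zero_of_forall_eval_embedding_eq_zero (b : Module.Basis (Fin n) ℚ K)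
    (e : Fin n ≃ (K →ₐ[ℚ] ℂ)) (f : MvPolynomial (Fin n) ℂ)
    (hf : ∀ x : K, eval (fun i => e i x) f = 0) : f = 0 := by
  set M := (Algebra.embeddingsMatrixReindex ℚ ℂ b e)ᵀ with hM
  apply linSubst_injective M (isUnit_det_embeddingsMatrix b e)
  rw [map_zero]
  apply MvPolynomial.funext_set (fun _ => Set.range ((↑) : ℚ → ℂ))
    (fun _ => Set.infinite_range_of_injective Rat.cast_injective)
  intro y hy
  rw [eval_linSubst, map_zero]
  have hy' : ∀ i, y i ∈ Set.range ((↑) : ℚ → ℂ) := Set.mem_univ_pi.mp hy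
  choose q hq using hy'
  have hyq : y = fun j => ((q j : ℚ) : ℂ) := by funext j; exact (hq j).symm
  -- the element with coordinates `q`
  set x : K := b.equivFun.symm q with hx
  have hrepr : ∀ j, b.repr x j = q j := by
    intro j
    have := b.equivFun.apply_symm_apply q
    rw [← this]
    rfl
  have hvec : M *ᵥ y = fun i => e i x := by
    rw [embedding_eq_mulVec b e x, hyq]
    congr 1
    funext j
    rw [hrepr j]
  rw [hvec]
  exact hf x

/-- The same with the variables indexed by the embeddings themselves. -/
theorem eq_zero_of_forall_eval_hom_eq_zero (f : MvPolynomial (K →ₐ[ℚ] ℂ) ℂ)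
    (hf : ∀ x : K, eval (fun σ : K →ₐ[ℚ] ℂ => σ x) f = 0) : f = 0 := by
  let e : Fin (Module.finrank ℚ K) ≃ (K →ₐ[ℚ] ℂ) :=
    (Fintype.equivFinOfCardEq (AlgHom.card ℚ K ℂ)).symm
  have hg : rename e.symm f = 0 := by
    apply eq_zero_of_forall_eval_embedding_eq_zero (Module.finBasis ℚ K) e
    intro x
    rw [eval_rename]
    have : ((fun i => e i x) ∘ e.symm) = fun σ : K →ₐ[ℚ] ℂ => σ x := by
      funext σ; simp
    rw [this]
    exact hf x
  exact (rename_injective e.symm e.symm.injective) (by rw [hg, map_zero])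

/-- A non-zero polynomial in the embedding variables is non-zero at some `x ∈ K`. -/
theorem exists_eval_hom_ne_zero {f : MvPolynomial (K →ₐ[ℚ] ℂ) ℂ} (hf : f ≠ 0) :
    ∃ x : K, eval (fun σ : K →ₐ[ℚ] ℂ => σ x) f ≠ 0 := by
  by_contra h
  push Not at h
  exact hf (eq_zero_of_forall_eval_hom_eq_zero f h)

/-- There is at least one embedding `K → ℂ`. -/
theorem nonempty_algHom : Nonempty (K →ₐ[ℚ] ℂ) := by
  have h : 0 < Fintype.card (K →ₐ[ℚ] ℂ) := by
    rw [AlgHom.card]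
    exact Module.finrank_pos
  exact Fintype.card_pos_iff.mp h

/-- **The torus form: the `ℚ`-points of `Res_{K/ℚ} 𝔾_m` are Zariski-dense.** A non-zero polynomial
in the embedding variables is non-zero at the embedding vector of some `x ∈ K^×`. -/
theorem exists_ne_zero_eval_hom_ne_zero {f : MvPolynomial (K →ₐ[ℚ] ℂ) ℂ} (hf : f ≠ 0) :
    ∃ x : K, x ≠ 0 ∧ eval (fun σ : K →ₐ[ℚ] ℂ => σ x) f ≠ 0 := by
  obtain ⟨σ₀⟩ := nonempty_algHom (K := K)
  have hf' : f * X σ₀ ≠ 0 := mul_ne_zero hf (X_ne_zero σ₀)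
  obtain ⟨x, hx⟩ := exists_eval_hom_ne_zero hf'
  rw [map_mul, eval_X] at hx
  refine ⟨x, ?_, left_ne_zero_of_mul hx⟩
  intro h0
  apply right_ne_zero_of_mul hx
  rw [h0, map_zero]

end Embeddings

end

end Summit.Ventures.HodgeRepro2.T5EmbeddingDensity
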